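import Literature.AlgebraicGeometry.Frobenioids.ArchimedeanBoundaryOpensEquiv
import HarnessLib

/-!
# Frobenioids II, Theorem 3.6 (vii), the equivalence `F^imtr-pre_A ⥲ Open⁰(∂A_A)` — PROVED for the
# angular Frobenioid `F = A`

Mochizuki, *The geometry of Frobenioids II*, Kyushu J. Math. **62** (2008) 401–460, §3, Theorem 3.6 (vii),
author's kurims text pp. 37–38 [cite: MochizukiFrdII2008, Thm 3.6 (vii) p.37]: "(vii) Suppose that
`Λ = ℤ`. Let `A ∈ Ob(F)` be complex [`F ∈ {C^Λ, A}`]. Then the assignment that maps an isometric pre-step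
`B → A` of `F` to the image of the boundary `∂A_B` […] determines an equivalence of categories
`F^imtr-pre_A ⥲ Open⁰(∂A_A)`".

DISCHARGE of `ArchFrd.Thm36vii_equiv` at the ANGULAR Frobenioid `A π ⊆ C π` of Example 3.3 (iii) (the
instance of `ArchimedeanTheoremsInstances.lean`: `A.toElem π` over the zero divisor monoid, ambient `ℂ^×`,
boundaries `bdA`, underlying maps `vMapA`): `thm36vii_equiv_A`. Since every arrow of `A` is isometric for
`A`'s own structure and the pre-steps of `A` over `X` are exactly the isometric pre-steps of `C` over `X`
(an arrow of `C` between two isometric pre-steps over `X` is itself an isometry), the category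
`A^imtr-pre_X` is equivalent — by the evident forgetful functor, an equivalence on the nose — to
`C^imtr-pre_X`, and the boundary-image functor of `A` is the composite with that of `C`
(`ArchimedeanBoundaryOpensEquiv.lean`). Everything is PROVED; no statement of the paper is strengthened.
-/

namespace Literature.AlgebraicGeometry.Frobenioids

open CategoryTheory Topology

noncomputable section

universe v u

namespace ArchFrd

variable {D : Type u} [Category.{v} D] (π : D ⥤ D0) (X : A π)

namespace A

/-- Forgetting that the arrows are tagged as isometries: `A^imtr-pre_X → C^imtr-pre_X`.
[cite: MochizukiFrdII2008, Thm 3.6 (vii) p.37] -/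
def imtrPreToC : ImtrPreOver (A.toElem π) X ⥤ ImtrPreOver (C.toElem π) X.obj where
  obj f := ⟨Over.mk f.obj.hom.1, ⟨f.obj.hom.2, f.property.2⟩⟩
  map {f f'} g := ObjectProperty.homMk (Over.homMk g.hom.left.1 (by
    change (g.hom.left ≫ f'.obj.hom).1 = f.obj.hom.1
    rw [Over.w g.hom]))
  map_id f := ImtrPre.hom_eq π X.obj _ _
  map_comp g g' := ImtrPre.hom_eq π X.obj _ _

/-- An arrow of `C` between isometric pre-steps over `X.obj` is an isometry of `C`, hence an arrow of `A`.
[cite: MochizukiFrdII2008, Ex 3.3 (iii) p.29] -/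
theorem isIsometry_left_of_over {f f' : ImtrPreOver (C.toElem π) X.obj} (g : f ⟶ f') :
    PreFrobenioid.IsIsometry (C.toElem π) g.hom.left :=
  ImtrPre.isIsometry_left g

/-- `A^imtr-pre_X → C^imtr-pre_X` is full. [cite: MochizukiFrdII2008, Thm 3.6 (vii) p.37] -/
theorem full_imtrPreToC : (imtrPreToC π X).Full where
  map_surjective {_ _} k :=
    ⟨ObjectProperty.homMk (Over.homMk ⟨k.hom.left, isIsometry_left_of_over π X k⟩
        (WideSubcategory.hom_ext _ (Over.w k.hom))),
      ImtrPre.hom_eq π X.obj _ _⟩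

/-- `A^imtr-pre_X → C^imtr-pre_X` is faithful (hom-sets of the target are subsingletons and the functor
reflects the underlying arrows). [cite: MochizukiFrdII2008, Thm 3.6 (vii) p.37] -/
theorem faithful_imtrPreToC : (imtrPreToC π X).Faithful where
  map_injective {_ _} g g' _ := by
    apply ObjectProperty.hom_ext
    apply Over.OverMorphism.ext
    apply WideSubcategory.hom_ext
    have h := ImtrPre.hom_eq π X.obj ((imtrPreToC π X).map g) ((imtrPreToC π X).map g')
    exact congrArg (fun k => k.hom.left) h

/-- `A^imtr-pre_X → C^imtr-pre_X` is essentially surjective (indeed surjective on objects: an isometric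
pre-step of `C` into `X.obj` is an arrow of `A`). [cite: MochizukiFrdII2008, Thm 3.6 (vii) p.37] -/
theorem essSurj_imtrPreToC : (imtrPreToC π X).EssSurj where
  mem_essImage f :=
    ⟨⟨Over.mk (Y := (⟨f.obj.left⟩ : A π)) (⟨f.obj.hom, f.property.1⟩ : (⟨f.obj.left⟩ : A π) ⟶ X),
        ⟨Subsingleton.elim _ _, f.property.2⟩⟩,
      ⟨eqToIso (by
        obtain ⟨⟨B, φ⟩, hφ⟩ := f
        rfl)⟩⟩

/-- `A^imtr-pre_X ⥲ C^imtr-pre_X`. [cite: MochizukiFrdII2008, Thm 3.6 (vii) p.37] -/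
theorem isEquivalence_imtrPreToC : (imtrPreToC π X).IsEquivalence where
  faithful := faithful_imtrPreToC π X
  full := full_imtrPreToC π X
  essSurj := essSurj_imtrPreToC π X

end A

/-- **Theorem 3.6 (vii), the equivalence `F^imtr-pre_A ⥲ Open⁰(∂A_A)`, for the angular Frobenioid `F = A`**
(PROVED over any base `π : D → D₀`): the boundary-image assignment of `A` factors as
`A^imtr-pre_X ⥲ C^imtr-pre_X ⥲ Open⁰(∂A_X)`. [cite: MochizukiFrdII2008, Thm 3.6 (vii) p.37] -/
theorem thm36vii_equiv_A :
    Thm36vii_equiv (baseRC π) (A.toElem π) MonoidType.Z (fun Y => ambient π Y.obj) (bdA π) (vMapA π) := by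
  intro _ X hXc
  have hπ : (π.obj X.obj.snd).IsComplex := (D0.isComplex_toArchBase_iff _).mp hXc
  have hc : X.obj.fst.IsComplexObj := by
    have e : X.obj.fst.base ⟶ π.obj X.obj.snd := X.obj.iso.hom
    rw [show π.obj X.obj.snd = D0.complex from hπ] at e
    exact D0.eq_complex_of_hom_complex e
  haveI := A.isEquivalence_imtrPreToC π X
  haveI := isEquivalence_bdFunctor π X.obj hc
  refine ⟨(A.imtrPreToC π X).asEquivalence.trans (bdFunctor π X.obj).asEquivalence, fun f => ?_⟩
  exact coe_image_bdOpen π X.obj ((A.imtrPreToC π X).obj f)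

end ArchFrd

end

end Literature.AlgebraicGeometry.Frobenioids
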